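import Summits.CriticalPhenomena.PercolationContinuityZ3.Theorems.PercNearOneGluingNoHeavyQuantFarRelayRowStar
import HarnessLib

/-!
# QUANT lane R8 — per-level lower bounds for the SPINE CERTIFICATE: Harris witness, union bound over closed cuts,
# and Cantelli (one-sided Chebyshev) for the relay count, in generic gate coordinates

builds on p205010 (kernel theorem, internal audit signed; external expert review pending)

Support file (`--supports stmt-CriticalPhenomena-4575`), QUANT lane typer seat prim-quant-stmt (gen 12), rung R8 of
`run/shared/lean/prim/quant/LADDER.md`.  The census's SPINE CERTIFICATE programme for FAR on trees (`Quant.FarTreeRow`;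
prim-quant-census-1/GX-MULTIBLOCK-G8.md §5–§6, README V117) writes `P(N ≥ j+1)` as a chain-indexed average of level
probabilities `P(S_k ≥ j+1)` (the spine identity; one step = `Quant.chain_step_real_general`, …QuantFarTreeChainStepGeneral.lean)
and bounds every level probability from below by the best of three elementary certificates.  This file supplies the three
certificates as kernel lemmas, in the generic gate vocabulary of the chain-step files (`prodBernoulli q` on `Set ι`, witnesses
`b : κ` with gate finsets `I b`, `b` reached iff `↑(I b) ⊆ ω`, count `N = #{b ∈ S | ↑(I b) ⊆ ω}`), with NO tree axiom needed:

* `Quant.reachedCount_ge_of_witness` — **Harris / best-witness bound**: for `O ⊆ S` with `k ≤ #O`,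
  `∏_{i ∈ ⋃_{b∈O} I b} q i ≤ P(N ≥ k)` (open all gates of the witnesses in `O`).
* `Quant.reachedCount_le_le_sum_cuts` — **union bound over closed cuts**: if every configuration with `N ≤ j` closes all
  gates of some member of a finite family `𝒯` of gate sets, then `P(N ≤ j) ≤ Σ_{T ∈ 𝒯} ∏_{i∈T} (1 − q i)`.
* `Quant.reachedCount_cantelli` — **Cantelli**: with `m = Σ_{b∈S} π(I b)` (`= E N`) and
  `s₂ = Σ_{b,b'∈S} π(I b ∪ I b')` (`= E N²`), for `j < m`:  `P(N ≤ j) ≤ (s₂ − m²)/((s₂ − m²) + (m − j)²)`.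
  Ingredients (finite-sum form, weights `∏_k (p k | 1 − p k)` as in …QuantIndepBlobMoments.lean): the indicator of
  `I b ⊆ W` is `∏_{i∈I b} 1_{i∈W}` (`prod_indicator_eq_ite_subset`), so `E 1[I b ⊆ W] = π(I b)` and
  `E 1[I b ⊆ W]·1[I b' ⊆ W] = π(I b ∪ I b')`; first and second moments of `N` (`sum_bernoulliWeight_mul_reachedCount(_sq)`);
  a generic Cantelli inequality on the weighted cube (`bernoulliWeight_cantelli`: `P(f ≤ j) ≤ V/(V + (m − j)²)`, Markov on
  `(m + u − f)²` optimised at `u = V/(m − j)`); the bridge `IndepBlob.prodBernoulli_real_eq_sum_finset`.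

Theorems only; no sorries; standard axioms.  [this work] for the assembly; the three inequalities are folklore
(Harris 1960 / union bound / Cantelli 1928); product measure [cite: Grimmett1999, §1.3 p. 10; §2.2].
-/

noncomputable section

namespace Summit.CriticalPhenomena.PercolationContinuityZ3.Theorems

namespace Quant

open Finset MeasureTheory
open Literature.Probability.LatticeModels
open Literature.Probability.Percolation
open scoped Classical

variable {ι κ : Type*}

/-! ### Harris witness and the union bound over closed cuts (measure form) -/

section Events

/-- **Best-witness (Harris) lower bound.**  Opening every gate of the witnesses of `O ⊆ S` reaches at least `#O ≥ k` of them: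
`∏_{i ∈ ⋃_{b∈O} I b} q i ≤ P(#{b ∈ S | I b open} ≥ k)`. [folklore; Harris 1960] -/
theorem reachedCount_ge_of_witness (q : ι → unitInterval) (S O : Finset κ) (I : κ → Finset ι) (hO : O ⊆ S)
    (k : ℕ) (hk : k ≤ O.card) :
    ∏ i ∈ O.biUnion I, (q i : ℝ) ≤
      (prodBernoulli q).real {ω : Set ι | k ≤ (S.filter fun b => ((I b : Finset ι) : Set ι) ⊆ ω).card} := by
  rw [← prodBernoulli_real_subset q (O.biUnion I)]
  refine measureReal_mono ?_ (measure_ne_top _ _)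
  intro ω hω
  have hω' : ((O.biUnion I : Finset ι) : Set ι) ⊆ ω := hω
  show k ≤ (S.filter fun b => ((I b : Finset ι) : Set ι) ⊆ ω).card
  have hsub : O ⊆ S.filter fun b => ((I b : Finset ι) : Set ι) ⊆ ω := by
    intro b hb
    rw [Finset.mem_filter]
    refine ⟨hO hb, fun i hi => hω' ?_⟩
    rw [Finset.mem_coe, Finset.mem_biUnion]
    exact ⟨b, hb, hi⟩
  exact hk.trans (Finset.card_le_card hsub)

/-- **Union bound over closed cuts.**  If every configuration reaching at most `j` witnesses of `S` closes all gates of some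
member `T` of the finite family `𝒯`, then `P(#{b ∈ S | I b open} ≤ j) ≤ Σ_{T∈𝒯} ∏_{i∈T} (1 − q i)`. [folklore] -/
theorem reachedCount_le_le_sum_cuts (q : ι → unitInterval) (S : Finset κ) (I : κ → Finset ι) (j : ℕ)
    (𝒯 : Finset (Finset ι))
    (h𝒯 : ∀ ω : Set ι, (S.filter fun b => ((I b : Finset ι) : Set ι) ⊆ ω).card ≤ j → ∃ T ∈ 𝒯, ∀ i ∈ T, i ∉ ω) :
    (prodBernoulli q).real {ω : Set ι | (S.filter fun b => ((I b : Finset ι) : Set ι) ⊆ ω).card ≤ j} ≤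
      ∑ T ∈ 𝒯, ∏ i ∈ T, (1 - (q i : ℝ)) := by
  set μ := prodBernoulli q with hμ
  have hsub : {ω : Set ι | (S.filter fun b => ((I b : Finset ι) : Set ι) ⊆ ω).card ≤ j} ⊆
      ⋃ T ∈ 𝒯, {ω : Set ι | ∀ i ∈ T, i ∉ ω} := by
    intro ω hω
    obtain ⟨T, hT, hTω⟩ := h𝒯 ω hω
    exact Set.mem_biUnion (Finset.mem_coe.2 hT) hTω
  calc μ.real {ω : Set ι | (S.filter fun b => ((I b : Finset ι) : Set ι) ⊆ ω).card ≤ j}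
      ≤ μ.real (⋃ T ∈ 𝒯, {ω : Set ι | ∀ i ∈ T, i ∉ ω}) := measureReal_mono hsub (measure_ne_top _ _)
    _ ≤ ∑ T ∈ 𝒯, μ.real {ω : Set ι | ∀ i ∈ T, i ∉ ω} := measureReal_biUnion_finset_le 𝒯 _
    _ = ∑ T ∈ 𝒯, ∏ i ∈ T, (1 - (q i : ℝ)) :=
        Finset.sum_congr rfl fun T _ => prodBernoulli_real_forall_notMem q T

end Events

/-! ### Moments of the reached count on the weighted cube (finite-sum form) -/

section Moments

variable [Fintype ι] [DecidableEq ι]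

omit [Fintype ι] in
/-- The indicator of `T ⊆ W` is the product of the gate indicators over `T`. [folklore] -/
theorem prod_indicator_eq_ite_subset (T W : Finset ι) :
    ∏ i ∈ T, (if i ∈ W then (1 : ℝ) else 0) = if T ⊆ W then 1 else 0 := by
  by_cases hTW : T ⊆ W
  · rw [if_pos hTW]
    exact Finset.prod_eq_one fun i hi => by rw [if_pos (hTW hi)]
  · rw [if_neg hTW]
    obtain ⟨i, hiT, hiW⟩ := Finset.not_subset.1 hTW
    exact Finset.prod_eq_zero hiT (by rw [if_neg hiW])

/-- `P(T ⊆ W) = ∏_{i∈T} p i` on the weighted cube. [folklore] -/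
theorem sum_bernoulliWeight_mul_ite_subset (p : ι → ℝ) (T : Finset ι) :
    ∑ W : Finset ι, (∏ k, if k ∈ W then p k else 1 - p k) * (if T ⊆ W then (1 : ℝ) else 0) = ∏ i ∈ T, p i := by
  rw [← IndepBlob.sum_bernoulliWeight_mul_prod_indicator p T]
  exact Finset.sum_congr rfl fun W _ => by rw [prod_indicator_eq_ite_subset]

omit [Fintype ι] in
/-- The reached count as a sum of subset indicators. [this work] -/
theorem reachedCount_eq_sum_ite (S : Finset κ) (I : κ → Finset ι) (W : Finset ι) :
    ((S.filter fun b => I b ⊆ W).card : ℝ) = ∑ b ∈ S, (if I b ⊆ W then (1 : ℝ) else 0) := by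
  rw [Finset.card_filter, Nat.cast_sum]
  exact Finset.sum_congr rfl fun b _ => by split_ifs <;> simp

/-- **First moment of the reached count**: `E N = Σ_{b∈S} ∏_{i∈I b} p i`. [folklore] -/
theorem sum_bernoulliWeight_mul_reachedCount (p : ι → ℝ) (S : Finset κ) (I : κ → Finset ι) :
    ∑ W : Finset ι, (∏ k, if k ∈ W then p k else 1 - p k) * ((S.filter fun b => I b ⊆ W).card : ℝ) =
      ∑ b ∈ S, ∏ i ∈ I b, p i := by
  have e : ∀ W : Finset ι, (∏ k, if k ∈ W then p k else 1 - p k) * ((S.filter fun b => I b ⊆ W).card : ℝ) =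
      ∑ b ∈ S, (∏ k, if k ∈ W then p k else 1 - p k) * (if I b ⊆ W then (1 : ℝ) else 0) := by
    intro W
    rw [reachedCount_eq_sum_ite, Finset.mul_sum]
  rw [Finset.sum_congr rfl fun W _ => e W, Finset.sum_comm]
  exact Finset.sum_congr rfl fun b _ => sum_bernoulliWeight_mul_ite_subset p (I b)

/-- **Second moment of the reached count**: `E N² = Σ_{b∈S} Σ_{b'∈S} ∏_{i ∈ I b ∪ I b'} p i`. [folklore] -/
theorem sum_bernoulliWeight_mul_reachedCount_sq (p : ι → ℝ) (S : Finset κ) (I : κ → Finset ι) :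
    ∑ W : Finset ι, (∏ k, if k ∈ W then p k else 1 - p k) * ((S.filter fun b => I b ⊆ W).card : ℝ) ^ 2 =
      ∑ b ∈ S, ∑ b' ∈ S, ∏ i ∈ I b ∪ I b', p i := by
  have e : ∀ W : Finset ι, (∏ k, if k ∈ W then p k else 1 - p k) * ((S.filter fun b => I b ⊆ W).card : ℝ) ^ 2 =
      ∑ b ∈ S, ∑ b' ∈ S, (∏ k, if k ∈ W then p k else 1 - p k) * (if I b ∪ I b' ⊆ W then (1 : ℝ) else 0) := by
    intro W
    rw [reachedCount_eq_sum_ite, sq, Finset.sum_mul_sum, Finset.mul_sum]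
    refine Finset.sum_congr rfl fun b _ => ?_
    rw [Finset.mul_sum]
    refine Finset.sum_congr rfl fun b' _ => ?_
    congr 1
    by_cases hb : I b ⊆ W <;> by_cases hb' : I b' ⊆ W
    · rw [if_pos hb, if_pos hb', if_pos (Finset.union_subset hb hb'), mul_one]
    · rw [if_pos hb, if_neg hb', if_neg (fun h => hb' ((Finset.subset_union_right).trans h)), mul_zero]
    · rw [if_neg hb, if_neg (fun h => hb ((Finset.subset_union_left).trans h)), zero_mul]
    · rw [if_neg hb, if_neg (fun h => hb ((Finset.subset_union_left).trans h)), zero_mul]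
  rw [Finset.sum_congr rfl fun W _ => e W, Finset.sum_comm]
  refine Finset.sum_congr rfl fun b _ => ?_
  rw [Finset.sum_comm]
  exact Finset.sum_congr rfl fun b' _ => sum_bernoulliWeight_mul_ite_subset p (I b ∪ I b')

/-- **Cantelli's inequality on the weighted cube** (one-sided Chebyshev).  For weights `∏_k (p k | 1 − p k)` with
`0 ≤ p ≤ 1`, a real observable `f` with mean `m` and variance `V`, and a level `j < m`:
`P(f ≤ j) ≤ V / (V + (m − j)²)`.  Proof: `(m − j + u)² P(f ≤ j) ≤ E (m + u − f)² = V + u²` for `u ≥ 0`, at `u = V/(m − j)`.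
[folklore; Cantelli 1928] -/
theorem bernoulliWeight_cantelli (p : ι → ℝ) (hp0 : ∀ i, 0 ≤ p i) (hp1 : ∀ i, p i ≤ 1) (f : Finset ι → ℝ) (m V j : ℝ)
    (hm : ∑ W : Finset ι, (∏ k, if k ∈ W then p k else 1 - p k) * f W = m)
    (hV : ∑ W : Finset ι, (∏ k, if k ∈ W then p k else 1 - p k) * (f W - m) ^ 2 = V) (hj : j < m) :
    ∑ W ∈ (Finset.univ : Finset (Finset ι)).filter (fun W => f W ≤ j), (∏ k, if k ∈ W then p k else 1 - p k) ≤
      V / (V + (m - j) ^ 2) := by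
  set P : ℝ := ∑ W ∈ (Finset.univ : Finset (Finset ι)).filter (fun W => f W ≤ j),
    (∏ k, if k ∈ W then p k else 1 - p k) with hP
  have hw0 : ∀ W : Finset ι, 0 ≤ (∏ k, if k ∈ W then p k else 1 - p k) := IndepBlob.bernoulliWeight_nonneg hp0 hp1
  have hV0 : 0 ≤ V := by
    rw [← hV]
    exact Finset.sum_nonneg fun W _ => mul_nonneg (hw0 W) (sq_nonneg _)
  have hd : 0 < m - j := by linarith
  -- `E (m + u − f)² = V + u²`
  have hexp : ∀ u : ℝ, ∑ W : Finset ι, (∏ k, if k ∈ W then p k else 1 - p k) * (m + u - f W) ^ 2 = V + u ^ 2 := by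
    intro u
    have e : ∀ W : Finset ι, (∏ k, if k ∈ W then p k else 1 - p k) * (m + u - f W) ^ 2 =
        (∏ k, if k ∈ W then p k else 1 - p k) * (f W - m) ^ 2
          - 2 * u * ((∏ k, if k ∈ W then p k else 1 - p k) * f W)
          + (2 * u * m + u ^ 2) * (∏ k, if k ∈ W then p k else 1 - p k) := fun W => by ring
    rw [Finset.sum_congr rfl fun W _ => e W, Finset.sum_add_distrib, Finset.sum_sub_distrib, hV, ← Finset.mul_sum, hm,
      ← Finset.mul_sum, IndepBlob.sum_bernoulliWeight]
    ring
  -- the Cantelli step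
  have step : ∀ u : ℝ, 0 ≤ u → (m - j + u) ^ 2 * P ≤ V + u ^ 2 := by
    intro u hu
    rw [← hexp u, hP, Finset.mul_sum]
    calc ∑ W ∈ (Finset.univ : Finset (Finset ι)).filter (fun W => f W ≤ j),
          (m - j + u) ^ 2 * (∏ k, if k ∈ W then p k else 1 - p k)
        ≤ ∑ W ∈ (Finset.univ : Finset (Finset ι)).filter (fun W => f W ≤ j),
            (∏ k, if k ∈ W then p k else 1 - p k) * (m + u - f W) ^ 2 := by
          refine Finset.sum_le_sum fun W hW => ?_
          rw [Finset.mem_filter] at hW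
          have hge : m - j + u ≤ m + u - f W := by linarith [hW.2]
          have hsq : (m - j + u) ^ 2 ≤ (m + u - f W) ^ 2 := pow_le_pow_left₀ (by linarith) hge 2
          rw [mul_comm]
          exact mul_le_mul_of_nonneg_left hsq (hw0 W)
      _ ≤ ∑ W : Finset ι, (∏ k, if k ∈ W then p k else 1 - p k) * (m + u - f W) ^ 2 :=
          Finset.sum_le_sum_of_subset_of_nonneg (Finset.filter_subset _ _) fun W _ _ => mul_nonneg (hw0 W) (sq_nonneg _)
  have key := step (V / (m - j)) (div_nonneg hV0 hd.le)
  -- algebra: `(m − j + V/(m−j))² = (V + (m−j)²)²/(m−j)²` and `V + (V/(m−j))² = V (V + (m−j)²)/(m−j)²`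
  have hD : 0 < V + (m - j) ^ 2 := by positivity
  rw [le_div_iff₀ hD]
  have e1 : (m - j + V / (m - j)) ^ 2 = (V + (m - j) ^ 2) ^ 2 / (m - j) ^ 2 := by
    field_simp
    ring
  have e2 : V + (V / (m - j)) ^ 2 = V * (V + (m - j) ^ 2) / (m - j) ^ 2 := by
    field_simp
    ring
  rw [e1, e2, div_mul_eq_mul_div, div_le_div_iff_of_pos_right (by positivity)] at key
  -- `key : (V + (m−j)²)² P ≤ V (V + (m−j)²)`
  have : (V + (m - j) ^ 2) * (P * (V + (m - j) ^ 2)) ≤ (V + (m - j) ^ 2) * V := by nlinarith [key]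
  exact le_of_mul_le_mul_left this hD

end Moments

/-! ### Cantelli for the reached count under `prodBernoulli` -/

section Cantelli

variable [Fintype ι] [DecidableEq ι]

/-- **Cantelli bound for the reached count.**  Under `prodBernoulli q` let `N = #{b ∈ S | I b open}`, with mean
`m = Σ_{b∈S} ∏_{i∈I b} q i` and second moment `s₂ = Σ_{b∈S} Σ_{b'∈S} ∏_{i ∈ I b ∪ I b'} q i`.  For every level `j < m`:
`P(N ≤ j) ≤ (s₂ − m²) / ((s₂ − m²) + (m − j)²)`.  (Generic gate sets `I b`: no tree axiom is used; on a tree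
`∏_{I b ∪ I b'} q = π(b) π(b') / π(b ∧ b')`.) [folklore; Cantelli 1928] -/
theorem reachedCount_cantelli (q : ι → unitInterval) (S : Finset κ) (I : κ → Finset ι) (j : ℝ)
    (hj : j < ∑ b ∈ S, ∏ i ∈ I b, (q i : ℝ)) :
    (prodBernoulli q).real {ω : Set ι | ((S.filter fun b => ((I b : Finset ι) : Set ι) ⊆ ω).card : ℝ) ≤ j} ≤
      ((∑ b ∈ S, ∑ b' ∈ S, ∏ i ∈ I b ∪ I b', (q i : ℝ)) - (∑ b ∈ S, ∏ i ∈ I b, (q i : ℝ)) ^ 2) /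
        (((∑ b ∈ S, ∑ b' ∈ S, ∏ i ∈ I b ∪ I b', (q i : ℝ)) - (∑ b ∈ S, ∏ i ∈ I b, (q i : ℝ)) ^ 2) +
          ((∑ b ∈ S, ∏ i ∈ I b, (q i : ℝ)) - j) ^ 2) := by
  set p : ι → ℝ := fun i => (q i : ℝ) with hp
  have hp0 : ∀ i, 0 ≤ p i := fun i => (q i).2.1
  have hp1 : ∀ i, p i ≤ 1 := fun i => (q i).2.2
  set m : ℝ := ∑ b ∈ S, ∏ i ∈ I b, (q i : ℝ) with hm
  set s₂ : ℝ := ∑ b ∈ S, ∑ b' ∈ S, ∏ i ∈ I b ∪ I b', (q i : ℝ) with hs₂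
  set f : Finset ι → ℝ := fun W => ((S.filter fun b => I b ⊆ W).card : ℝ) with hf
  have hmean : ∑ W : Finset ι, (∏ k, if k ∈ W then p k else 1 - p k) * f W = m :=
    sum_bernoulliWeight_mul_reachedCount p S I
  have hsq : ∑ W : Finset ι, (∏ k, if k ∈ W then p k else 1 - p k) * f W ^ 2 = s₂ :=
    sum_bernoulliWeight_mul_reachedCount_sq p S I
  have hvar : ∑ W : Finset ι, (∏ k, if k ∈ W then p k else 1 - p k) * (f W - m) ^ 2 = s₂ - m ^ 2 := by
    have e : ∀ W : Finset ι, (∏ k, if k ∈ W then p k else 1 - p k) * (f W - m) ^ 2 =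
        (∏ k, if k ∈ W then p k else 1 - p k) * f W ^ 2 - 2 * m * ((∏ k, if k ∈ W then p k else 1 - p k) * f W)
          + m ^ 2 * (∏ k, if k ∈ W then p k else 1 - p k) := fun W => by ring
    rw [Finset.sum_congr rfl fun W _ => e W, Finset.sum_add_distrib, Finset.sum_sub_distrib, hsq, ← Finset.mul_sum, hmean,
      ← Finset.mul_sum, IndepBlob.sum_bernoulliWeight]
    ring
  -- the event in finite-sum form
  rw [IndepBlob.prodBernoulli_real_eq_sum_finset q]
  calc _ = ∑ W ∈ (Finset.univ : Finset (Finset ι)).filter (fun W => f W ≤ j),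
        (∏ k, if k ∈ W then p k else 1 - p k) := by
          refine Finset.sum_congr ?_ (fun _ _ => rfl)
          ext s
          simp only [Finset.mem_filter, Finset.mem_univ, true_and, Set.mem_setOf_eq, hf, Finset.coe_subset]
    _ ≤ _ := bernoulliWeight_cantelli p hp0 hp1 f m (s₂ - m ^ 2) j hmean hvar hj

/-- **Cantelli bound, layer form.**  With `N`, `m`, `s₂` as in `reachedCount_cantelli` and an integer layer `j` with `j < m`:
`P(N ≤ j) ≤ (s₂ − m²)/((s₂ − m²) + (m − j)²)`. [folklore; Cantelli 1928] -/
theorem reachedCount_cantelli_nat (q : ι → unitInterval) (S : Finset κ) (I : κ → Finset ι) (j : ℕ)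
    (hj : (j : ℝ) < ∑ b ∈ S, ∏ i ∈ I b, (q i : ℝ)) :
    (prodBernoulli q).real {ω : Set ι | (S.filter fun b => ((I b : Finset ι) : Set ι) ⊆ ω).card ≤ j} ≤
      ((∑ b ∈ S, ∑ b' ∈ S, ∏ i ∈ I b ∪ I b', (q i : ℝ)) - (∑ b ∈ S, ∏ i ∈ I b, (q i : ℝ)) ^ 2) /
        (((∑ b ∈ S, ∑ b' ∈ S, ∏ i ∈ I b ∪ I b', (q i : ℝ)) - (∑ b ∈ S, ∏ i ∈ I b, (q i : ℝ)) ^ 2) +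
          ((∑ b ∈ S, ∏ i ∈ I b, (q i : ℝ)) - j) ^ 2) := by
  have hset : {ω : Set ι | (S.filter fun b => ((I b : Finset ι) : Set ι) ⊆ ω).card ≤ j} =
      {ω : Set ι | ((S.filter fun b => ((I b : Finset ι) : Set ι) ⊆ ω).card : ℝ) ≤ (j : ℝ)} := by
    ext ω
    simp only [Set.mem_setOf_eq, Nat.cast_le]
  rw [hset]
  exact reachedCount_cantelli q S I (j : ℝ) hj

/-- Monotonicity of the Cantelli expression in the variance: `V ≤ V'` gives `V/(V + D) ≤ V'/(V' + D)` for `D > 0`, `0 ≤ V`.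
[folklore] -/
theorem cantelli_expr_mono {V V' D : ℝ} (hV : 0 ≤ V) (hVV' : V ≤ V') (hD : 0 < D) :
    V / (V + D) ≤ V' / (V' + D) := by
  rw [div_le_div_iff₀ (add_pos_of_nonneg_of_pos hV hD) (add_pos_of_nonneg_of_pos (hV.trans hVV') hD)]
  nlinarith

/-- **Cantelli bound with a variance majorant.**  In the setting of `reachedCount_cantelli_nat`, any upper bound `V'` of the
variance `s₂ − m²` may be used: `P(N ≤ j) ≤ V'/(V' + (m − j)²)` for `j < m`. [folklore; Cantelli 1928] -/
theorem reachedCount_cantelli_of_var_le (q : ι → unitInterval) (S : Finset κ) (I : κ → Finset ι) (j : ℕ) (V' : ℝ)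
    (hj : (j : ℝ) < ∑ b ∈ S, ∏ i ∈ I b, (q i : ℝ))
    (hV' : (∑ b ∈ S, ∑ b' ∈ S, ∏ i ∈ I b ∪ I b', (q i : ℝ)) - (∑ b ∈ S, ∏ i ∈ I b, (q i : ℝ)) ^ 2 ≤ V') :
    (prodBernoulli q).real {ω : Set ι | (S.filter fun b => ((I b : Finset ι) : Set ι) ⊆ ω).card ≤ j} ≤
      V' / (V' + ((∑ b ∈ S, ∏ i ∈ I b, (q i : ℝ)) - j) ^ 2) := by
  set p : ι → ℝ := fun i => (q i : ℝ) with hp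
  have hp0 : ∀ i, 0 ≤ p i := fun i => (q i).2.1
  have hp1 : ∀ i, p i ≤ 1 := fun i => (q i).2.2
  set m : ℝ := ∑ b ∈ S, ∏ i ∈ I b, (q i : ℝ) with hm
  set s₂ : ℝ := ∑ b ∈ S, ∑ b' ∈ S, ∏ i ∈ I b ∪ I b', (q i : ℝ) with hs₂
  -- the variance is nonnegative (it is a sum of nonnegative terms on the cube)
  have hV0 : 0 ≤ s₂ - m ^ 2 := by
    set f : Finset ι → ℝ := fun W => ((S.filter fun b => I b ⊆ W).card : ℝ) with hf
    have hmean : ∑ W : Finset ι, (∏ k, if k ∈ W then p k else 1 - p k) * f W = m :=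
      sum_bernoulliWeight_mul_reachedCount p S I
    have hsq : ∑ W : Finset ι, (∏ k, if k ∈ W then p k else 1 - p k) * f W ^ 2 = s₂ :=
      sum_bernoulliWeight_mul_reachedCount_sq p S I
    have hvar : ∑ W : Finset ι, (∏ k, if k ∈ W then p k else 1 - p k) * (f W - m) ^ 2 = s₂ - m ^ 2 := by
      have e : ∀ W : Finset ι, (∏ k, if k ∈ W then p k else 1 - p k) * (f W - m) ^ 2 =
          (∏ k, if k ∈ W then p k else 1 - p k) * f W ^ 2 - 2 * m * ((∏ k, if k ∈ W then p k else 1 - p k) * f W)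
            + m ^ 2 * (∏ k, if k ∈ W then p k else 1 - p k) := fun W => by ring
      rw [Finset.sum_congr rfl fun W _ => e W, Finset.sum_add_distrib, Finset.sum_sub_distrib, hsq, ← Finset.mul_sum, hmean,
        ← Finset.mul_sum, IndepBlob.sum_bernoulliWeight]
      ring
    rw [← hvar]
    exact Finset.sum_nonneg fun W _ => mul_nonneg (IndepBlob.bernoulliWeight_nonneg hp0 hp1 W) (sq_nonneg _)
  have hD : 0 < (m - j) ^ 2 := by
    have : 0 < m - j := by linarith
    positivity
  exact (reachedCount_cantelli_nat q S I j hj).trans (cantelli_expr_mono hV0 hV' hD)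

end Cantelli

end Quant

end Summit.CriticalPhenomena.PercolationContinuityZ3.Theorems
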